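import Summits.Ventures.CertifiedArithmetic.Expansions.CompressRipplePrecTwo
import Summits.Ventures.CertifiedArithmetic.Expansions.CompressLocality
import Summits.Ventures.CertifiedArithmetic.Expansions.CompressFixedPointChain
import Summits.Ventures.CertifiedArithmetic.Expansions.CompressPassesUnboundedGeneric
import Mathlib.Tactic.Linarith
import Mathlib.Tactic.Positivity
import Mathlib.Tactic.Ring
import Mathlib.Tactic.NormNum

/-!
# COMPRESS can need any number of passes — also at precision `p = 2` (new work)

New work of the certified-arithmetic venture (ENGINES group: shared numerical engines serving
client cells; rigour lives in the verifiers; every published number belongs to a client cell's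
ledger, not to the engines group).  NOT a published theorem: Shewchuk [Shewchuk1997, §2.7] proves
Theorem 23 about ONE pass of COMPRESS and says nothing about iterating it.
`CompressPassesUnboundedGeneric.lean` settles every precision `p ≥ 3`; this file settles the
remaining IEEE-style precision `p = 2` (ties-to-even `roundTiesEven 2 emin`, `emin ≤ 0`) with the
ripple blocks of `CompressRipplePrecTwo.lean`, and records the union over all `p ≥ 2`.

THE STATES.  `stateP2 k r = ramp2 1 0 k ++ zig3 (−1) (2k) r ++ ramp2 ((−1)^r) (2k+3r) r ++
zig3 (−(−1)^r) (2k+5r) k` (`2(k+r)` components: a bottom run `1, 4, …, 4^(k−1)`, `r` kinks, a run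
of `r`, a frozen tail of `k` kinks).  ONE PASS OF COMPRESS maps `stateP2 k (r+1)` to
`stateP2 (k+1) r` (`compress_stateP2_succ`): in the downward sweep the run slides down intact, every
kink FastTwoSums with the carry (`8·x + 3·x → (12·x, −x)`: the kink moves up two binades, the
carry drops three and flips sign) and the bottom run absorbs the final carry; in the upward sweep
every sum is inert except along the run, whose members are renamed one binade down with the
opposite sign while its top member freezes into the tail.  So EVERY component changes — there is
no travelling kink at `p = 2` (exhaustive search over small windows finds none) — and each pass
retires exactly one kink: `stateP2 k 0` is a chain, hence fixed (`compress_stateP2_zero`).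
THE FAMILY `ripple2 k = stateP2 0 (k+1)` (`2k + 2` components `−3, 24, −192, …` then a run) is a
nonoverlapping expansion of precision-2 floats (`isExpansion_ripple2`, `isFloat_of_mem_ripple2`) on
which COMPRESS changes its input in each of the first `k + 1` passes and is fixed afterwards
(`ripple2_passes`, `ripple2_pass_changes`, `compress_passes_unbounded_prec_two`); with the generic
family this gives `compress_passes_unbounded_every_prec`: **at every precision `p ≥ 2`, no bound
on the number of COMPRESS passes holds uniformly in the length of the expansion.**  Found and
checked numerically first (engines desk: exact integer model of COMPRESS at `p = 2`; the pass
count `n/2` of this family is the largest found for every length `n ≤ 26` by beam search).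

References: J. R. Shewchuk, Discrete Comput. Geom. 18 (1997) 305–363, §2.7 [Shewchuk1997];
rounding to nearest even [BoldoEtAl2023, §2.2]; floats [JeannerodRump2018].
-/

namespace Summit.Ventures.CertifiedArithmetic.Expansions

open Literature.ComputerArithmetic.JeannerodRump2018
open Literature.ComputerArithmetic.BoldoJeannerodMelquiondMuller2023 hiding twoSum twoSum_fst
open Literature.ComputerArithmetic.Shewchuk1997
open Literature.ComputerArithmetic.Roux2014

variable {em emin : ℤ} {σ τ : ℚ}

/-! ### The downward and upward sweeps over the blocks -/

section sweeps
variable (he : emin ≤ 0)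
include he

/-- DOWN A RUN (inert): from the carry `τ·2^(E+2n)` over the reversed run `τ·2^(E+2(n−1)), …, τ·2^E`
every component is emitted and the bottom `τ·2^E` is handed on.
[cite: Shewchuk1997, §2.7 p. 332, Lines 1–9] -/
theorem down_ramp2 (hτ : τ = 1 ∨ τ = -1) : ∀ (n E : ℕ) (rest : List ℚ),
    compressDown (roundTiesEven 2 emin) (τ * 2 ^ (E + 2 * n)) ((ramp2 τ E n).reverse ++ rest) =
      ((ramp2 τ (E + 2) n).reverse ++ (compressDown (roundTiesEven 2 emin) (τ * 2 ^ E) rest).1,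
        (compressDown (roundTiesEven 2 emin) (τ * 2 ^ E) rest).2)
  | 0, E, rest => by simp
  | n + 1, E, rest => by
    obtain ⟨hab, hb, hb0⟩ := link_run he hτ (E + 2 * n)
    have hfts :
        fastTwoSum (roundTiesEven 2 emin) (τ * 2 ^ (E + 2 * (n + 1))) (τ * 2 ^ (E + 2 * n)) =
        (τ * 2 ^ (E + 2 * (n + 1)), τ * 2 ^ (E + 2 * n)) := by
      rw [show E + 2 * (n + 1) = E + 2 * n + 2 by ring]
      exact fastTwoSum_eq_of_absorb rne2_zero hb hab
    rw [ramp2_succ_eq_append, List.reverse_append, List.reverse_singleton, List.singleton_append,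
      List.cons_append, compressDown_cons_of_ne_zero (by rw [hfts]; exact hb0), hfts]
    dsimp only
    rw [down_ramp2 hτ n E rest, ramp2_succ_eq_append, List.reverse_append, List.reverse_singleton,
      List.singleton_append, List.cons_append, show E + 2 + 2 * n = E + 2 * (n + 1) by ring]

/-- DOWN THE KINKS (active): from the carry `∓2^(e+3n+…)` matching the top kink, each kink
`ς·3·2^c` met by `ς·2^(c+3)` emits `ς·3·2^(c+2)` and hands `−ς·2^c` down — the cascade; at the
bottom the carry `−σ·2^e` is handed on. [cite: Shewchuk1997, §2.7 p. 332, Lines 1–9] -/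
theorem down_zig3 : ∀ (n e : ℕ) (σ : ℚ), (σ = 1 ∨ σ = -1) → ∀ rest : List ℚ,
    compressDown (roundTiesEven 2 emin) (-σ * (-1) ^ n * 2 ^ (e + 3 * n))
        ((zig3 σ e n).reverse ++ rest) =
      ((zig3 σ (e + 2) n).reverse ++ (compressDown (roundTiesEven 2 emin) (-σ * 2 ^ e) rest).1,
        (compressDown (roundTiesEven 2 emin) (-σ * 2 ^ e) rest).2)
  | 0, e, σ, hσ, rest => by simp
  | n + 1, e, σ, hσ, rest => by
    have hς : σ * (-1) ^ n = 1 ∨ σ * (-1) ^ n = -1 := by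
      rcases hσ with rfl | rfl <;> rcases neg_one_pow_eq_or ℚ n with h | h <;> simp [h]
    have hfts := f2s_kink he hς (e + 3 * n)
    have hc : -σ * (-1) ^ (n + 1) * 2 ^ (e + 3 * (n + 1)) = σ * (-1) ^ n * 2 ^ (e + 3 * n + 3) := by
      rw [pow_succ, show e + 3 * (n + 1) = e + 3 * n + 3 by ring]; ring
    have hne : (fastTwoSum (roundTiesEven 2 emin) (σ * (-1) ^ n * 2 ^ (e + 3 * n + 3))
        (σ * (-1) ^ n * 3 * 2 ^ (e + 3 * n))).2 ≠ 0 := by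
      rw [hfts]; rcases hς with h | h <;> simp [h]
    rw [zig3_succ_eq_append, List.reverse_append, List.reverse_singleton, List.singleton_append,
      List.cons_append, hc, compressDown_cons_of_ne_zero hne, hfts]
    dsimp only
    rw [show -(σ * (-1) ^ n) * (2 : ℚ) ^ (e + 3 * n) = -σ * (-1) ^ n * 2 ^ (e + 3 * n) by ring,
      down_zig3 n e σ hσ rest, zig3_succ_eq_append, List.reverse_append, List.reverse_singleton,
      List.singleton_append, List.cons_append, show e + 2 + 3 * n = e + 3 * n + 2 by ring]

/-! ### The upward sweep -/

/-- UP A RUN (active): the carry `τ·3·2^b` under the run component `τ·2^(b+3)` emits `−τ·2^b` and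
climbs as `τ·3·2^(b+2)`. [cite: Shewchuk1997, §2.7 p. 332, Lines 10–16] -/
theorem up_ramp2 (hτ : τ = 1 ∨ τ = -1) : ∀ (n b : ℕ) (rest : List ℚ),
    compressUp (roundTiesEven 2 emin) (τ * 3 * 2 ^ b) (ramp2 τ (b + 3) n ++ rest) =
      ramp2 (-τ) b n ++ compressUp (roundTiesEven 2 emin) (τ * 3 * 2 ^ (b + 2 * n)) rest
  | 0, b, rest => by simp
  | n + 1, b, rest => by
    have hfts := f2s_kink he hτ b
    have hne : (fastTwoSum (roundTiesEven 2 emin) (τ * 2 ^ (b + 3)) (τ * 3 * 2 ^ b)).2 ≠ 0 := by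
      rw [hfts]; rcases hτ with h | h <;> simp [h]
    rw [ramp2_succ, List.cons_append, compressUp_cons_of_ne_zero hne, hfts]
    dsimp only
    rw [show b + 3 + 2 = b + 2 + 3 by ring, up_ramp2 hτ n (b + 2) rest, ramp2_succ,
      show b + 2 + 2 * n = b + 2 * (n + 1) by ring, List.cons_append]

end sweeps

/-! ### One pass on the active window `kinks ++ run` -/

section window
variable (he : emin ≤ 0)
include he

/-- The downward sweep of the window: from the top run component over the rest of the run
(inert) and down the kink cascade (active); bottom carry `−σ·2^e`.
[cite: Shewchuk1997, §2.7 p. 332, Lines 1–9] -/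
theorem down_window (hσ : σ = 1 ∨ σ = -1) (e r : ℕ) :
    compressDown (roundTiesEven 2 emin) (σ * (-1) ^ r * 2 ^ (e + 3 * r + 3 + 2 * r))
        ((zig3 σ e (r + 1) ++ ramp2 (σ * (-1) ^ r) (e + 3 * r + 3) r).reverse) =
      ((ramp2 (σ * (-1) ^ r) (e + 3 * r + 3 + 2) r).reverse ++ (zig3 σ (e + 2) (r + 1)).reverse,
        -σ * 2 ^ e) := by
  have hς : σ * (-1) ^ r = 1 ∨ σ * (-1) ^ r = -1 := by
    rcases hσ with rfl | rfl <;> rcases neg_one_pow_eq_or ℚ r with h | h <;> simp [h]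
  rw [List.reverse_append, down_ramp2 he hς r (e + 3 * r + 3)]
  have hc : σ * (-1) ^ r * (2 : ℚ) ^ (e + 3 * r + 3) =
      -σ * (-1) ^ (r + 1) * 2 ^ (e + 3 * (r + 1)) := by
    rw [pow_succ, show e + 3 * (r + 1) = e + 3 * r + 3 by ring]; ring
  have hd := down_zig3 he (r + 1) e σ hσ []
  rw [List.append_nil] at hd
  rw [hc, hd]
  simp

/-- ONE PASS ON THE WINDOW: `COMPRESS(kinks ++ run)` = bottom carry, the kinks lifted by two
binades (one fewer), the run lowered by one binade with its sign flipped (one fewer), and the new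
top `τ·3·2^(…)`. [cite: Shewchuk1997, §2.7 p. 332 (COMPRESS)] -/
theorem compress_window (hσ : σ = 1 ∨ σ = -1) (e r : ℕ) :
    compress (roundTiesEven 2 emin)
        (zig3 σ e (r + 1) ++ ramp2 (σ * (-1) ^ r) (e + 3 * r + 3) (r + 1)) =
      -σ * 2 ^ e :: (zig3 σ (e + 2) r ++ (ramp2 (-(σ * (-1) ^ r)) (e + 3 * r + 2) r ++
        [σ * (-1) ^ r * 3 * 2 ^ (e + 3 * r + 2 + 2 * r)])) := by
  have hς : σ * (-1) ^ r = 1 ∨ σ * (-1) ^ r = -1 := by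
    rcases hσ with rfl | rfl <;> rcases neg_one_pow_eq_or ℚ r with h | h <;> simp [h]
  have hnσ : -σ = 1 ∨ -σ = -1 := by rcases hσ with rfl | rfl <;> norm_num
  rw [ramp2_succ_eq_append _ (e + 3 * r + 3) r, ← List.append_assoc, compress_concat,
    down_window he hσ e r]
  dsimp only
  rw [List.reverse_append, List.reverse_reverse, List.reverse_reverse,
    zig3_succ_eq_append σ (e + 2) r, List.append_assoc, List.singleton_append]
  -- up through the kinks (inert)
  have hlink := link_cross he hnσ e
  simp only [neg_neg] at hlink
  have hchain : List.IsChain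
      (fun a b => roundTiesEven 2 emin (b + a) = b ∧ roundTiesEven 2 emin a = a ∧ a ≠ 0)
      (-σ * 2 ^ e :: (zig3 σ (e + 2) r ++ [σ * (-1) ^ r * 3 * 2 ^ (e + 2 + 3 * r)])) := by
    rw [← zig3_succ_eq_append]
    exact isChain_cons_zig3 he hσ (e + 2) (r + 1) hlink
  rw [compressUp_append_of_isChain rne2_zero _ _ _ _ hchain]
  -- up the run (active)
  have hu := up_ramp2 he hς r (e + 3 * r + 2) []
  rw [List.append_nil] at hu
  rw [show e + 2 + 3 * r = e + 3 * r + 2 by ring,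
    show e + 3 * r + 3 + 2 = e + 3 * r + 2 + 3 by ring,
    hu, compressUp_nil]

end window

/-! ### The states of the ripple and one pass of COMPRESS on them -/

/-- THE STATE with `k` bottom components `1, 4, …, 4^(k−1)`, `r` kinks `∓3·2^(2k+3i)`, the run
`±2^(2k+3r+2j)` (`j < r`) and the frozen tail `∓3·2^(2k+5r+3m)` (`m < k`) — `2(k+r)` components. -/
def stateP2 (k r : ℕ) : List ℚ :=
  ramp2 1 0 k ++ (zig3 (-1) (2 * k) r ++ ramp2 ((-1) ^ r) (2 * k + 3 * r) r) ++
    zig3 (-(-1) ^ r) (2 * k + 5 * r) k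

/-- Lengths. -/
theorem length_stateP2 (k r : ℕ) : (stateP2 k r).length = 2 * (k + r) := by
  simp only [stateP2, List.length_append, length_ramp2, length_zig3]; ring

section pass
variable (he : emin ≤ 0)
include he

/-- **ONE PASS**: `COMPRESS(stateP2 k (r+1)) = stateP2 (k+1) r` — the lowest kink is absorbed into
the bottom run, every other kink moves up two binades, the run moves down one binade and flips its
sign, and its top component freezes into the tail. [cite: Shewchuk1997, §2.7 p. 332 (COMPRESS)] -/
theorem compress_stateP2_succ (k r : ℕ) :
    compress (roundTiesEven 2 emin) (stateP2 k (r + 1)) = stateP2 (k + 1) r := by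
  have hς : (-1 : ℚ) * (-1) ^ r = 1 ∨ (-1 : ℚ) * (-1) ^ r = -1 := by
    rcases neg_one_pow_eq_or ℚ r with h | h <;> simp [h]
  have hς' : -((-1 : ℚ) * (-1) ^ r) = 1 ∨ -((-1 : ℚ) * (-1) ^ r) = -1 := by
    rcases neg_one_pow_eq_or ℚ r with h | h <;> simp [h]
  -- present the state as `low ++ (midrest ++ [M]) ++ high`
  have hst : stateP2 k (r + 1) = ramp2 1 0 k ++
      ((zig3 (-1) (2 * k) (r + 1) ++ ramp2 ((-1) * (-1) ^ r) (2 * k + 3 * r + 3) r) ++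
        [(-1) * (-1) ^ r * 2 ^ (2 * k + 3 * r + 3 + 2 * r)]) ++
      zig3 (-((-1) * (-1) ^ r)) (2 * k + 3 * r + 3 + 2 * r + 2) k := by
    rw [stateP2, show ((-1 : ℚ)) ^ (r + 1) = (-1) * (-1) ^ r by ring,
      show 2 * k + 3 * (r + 1) = 2 * k + 3 * r + 3 by ring,
      show 2 * k + 5 * (r + 1) = 2 * k + 3 * r + 3 + 2 * r + 2 by ring, ramp2_succ_eq_append,
      List.append_assoc (zig3 _ _ _)]
  -- the window pass, presented as `ys ++ [T]`
  have hwin := compress_window he (σ := -1) (Or.inr rfl) (2 * k) r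
  rw [ramp2_succ_eq_append _ (2 * k + 3 * r + 3) r, ← List.append_assoc] at hwin
  have hys : compress (roundTiesEven 2 emin)
      ((zig3 (-1) (2 * k) (r + 1) ++ ramp2 ((-1) * (-1) ^ r) (2 * k + 3 * r + 3) r) ++
        [(-1) * (-1) ^ r * 2 ^ (2 * k + 3 * r + 3 + 2 * r)]) =
      (-(-1) * 2 ^ (2 * k) :: (zig3 (-1) (2 * k + 2) r ++
        ramp2 (-((-1) * (-1) ^ r)) (2 * k + 3 * r + 2) r)) ++
        [(-1) * (-1) ^ r * 3 * 2 ^ (2 * k + 3 * r + 2 + 2 * r)] := by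
    rw [hwin]; simp
  -- the bottom carry of the window's downward sweep
  have hbot : (compressDown (roundTiesEven 2 emin)
      ((-1) * (-1) ^ r * 2 ^ (2 * k + 3 * r + 3 + 2 * r))
      (zig3 (-1) (2 * k) (r + 1) ++ ramp2 ((-1) * (-1) ^ r) (2 * k + 3 * r + 3) r).reverse).2 =
      1 * 2 ^ (0 + 2 * k) := by
    rw [down_window he (σ := -1) (Or.inr rfl) (2 * k) r]; ring
  have hlow : List.IsChain
      (fun a b => roundTiesEven 2 emin (b + a) = b ∧ roundTiesEven 2 emin a = a ∧ a ≠ 0)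
      (ramp2 1 0 k ++ [(compressDown (roundTiesEven 2 emin)
        ((-1) * (-1) ^ r * 2 ^ (2 * k + 3 * r + 3 + 2 * r))
        (zig3 (-1) (2 * k) (r + 1) ++
          ramp2 ((-1) * (-1) ^ r) (2 * k + 3 * r + 3) r).reverse).2]) := by
    rw [hbot, ← ramp2_succ_eq_append]
    exact isChain_ramp2 he (k + 1) 0 1 (Or.inl rfl)
  have hM : List.IsChain
      (fun a b => roundTiesEven 2 emin (b + a) = b ∧ roundTiesEven 2 emin a = a ∧ a ≠ 0)
      ((-1) * (-1) ^ r * 2 ^ (2 * k + 3 * r + 3 + 2 * r) ::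
        zig3 (-((-1) * (-1) ^ r)) (2 * k + 3 * r + 3 + 2 * r + 2) k) :=
    isChain_cons_zig3 he hς' _ k (link_cross he hς (2 * k + 3 * r + 3 + 2 * r))
  have hT : List.IsChain
      (fun a b => roundTiesEven 2 emin (b + a) = b ∧ roundTiesEven 2 emin a = a ∧ a ≠ 0)
      ((-1) * (-1) ^ r * 3 * 2 ^ (2 * k + 3 * r + 2 + 2 * r) ::
        zig3 (-((-1) * (-1) ^ r)) (2 * k + 3 * r + 3 + 2 * r + 2) k) := by
    rw [show 2 * k + 3 * r + 3 + 2 * r + 2 = (2 * k + 3 * r + 2 + 2 * r) + 3 by ring]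
    exact isChain_cons_zig3 he hς' _ k (link_alt he hς (2 * k + 3 * r + 2 + 2 * r))
  rw [hst, compress_append3_of_isChain rne2_zero hlow hys hM hT, hys, stateP2, ramp2_succ_eq_append,
    zig3_succ, show 2 * (k + 1) = 2 * k + 2 by ring,
    show 2 * k + 2 + 3 * r = 2 * k + 3 * r + 2 by ring,
    show 2 * k + 2 + 5 * r = 2 * k + 3 * r + 2 + 2 * r by ring,
    show 2 * k + 3 * r + 2 + 2 * r + 3 = 2 * k + 3 * r + 3 + 2 * r + 2 by ring,
    show ((-1 : ℚ)) ^ r = -((-1) * (-1) ^ r) by ring]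
  simp

end pass

/-! ### The fixed point and the iterates -/

section passes
variable (he : emin ≤ 0)
include he

/-- **THE FIXED POINT**: with no kink left, `stateP2 (k+1) 0` (bottom run, frozen tail) is a chain,
so COMPRESS returns it unchanged. [cite: Shewchuk1997, §2.7 p. 332 (COMPRESS)] -/
theorem compress_stateP2_zero (k : ℕ) :
    compress (roundTiesEven 2 emin) (stateP2 (k + 1) 0) = stateP2 (k + 1) 0 := by
  have hst : stateP2 (k + 1) 0 = ramp2 1 0 (k + 1) ++ zig3 (-1) (0 + 2 * k + 2) (k + 1) := by
    simp only [stateP2, zig3_zero, ramp2_zero, List.append_nil, pow_zero, mul_zero, add_zero]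
    rw [show 2 * (k + 1) = 0 + 2 * k + 2 by ring]
  rw [hst]
  exact compress_eq_self_of_isChain rne2_zero (isChain_ramp2_zig3 he (Or.inl rfl) k 0 (k + 1))

/-- `j ≤ N` passes on `stateP2 0 N` give `stateP2 j (N − j)`. [cite: Shewchuk1997, §2.7 p. 332] -/
theorem compress_iterate_stateP2 (N : ℕ) : ∀ j : ℕ, j ≤ N →
    (compress (roundTiesEven 2 emin))^[j] (stateP2 0 N) = stateP2 j (N - j)
  | 0, _ => by simp
  | j + 1, hj => by
    obtain ⟨m, hm⟩ : ∃ m, N - j = m + 1 := ⟨N - j - 1, by omega⟩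
    rw [Function.iterate_succ_apply', compress_iterate_stateP2 N j (by omega), hm,
      compress_stateP2_succ he, show N - (j + 1) = m by omega]

end passes

/-! ### The family and its passes -/

/-- THE FAMILY at precision 2: `k + 1` kinks `−3, 3·2^3, −3·2^6, …` under a run of `k + 1`
components of ratio 4 — `2k + 2` components. -/
def ripple2 (k : ℕ) : List ℚ := stateP2 0 (k + 1)

/-- Unfolding: the family is the kink block followed by the run. -/
theorem ripple2_eq (k : ℕ) :
    ripple2 k = zig3 (-1) 0 (k + 1) ++ ramp2 ((-1) ^ (k + 1)) (3 * (k + 1)) (k + 1) := by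
  simp [ripple2, stateP2]

/-- `ripple2 k` has `2k + 2` components. -/
theorem length_ripple2 (k : ℕ) : (ripple2 k).length = 2 * k + 2 := by
  rw [ripple2, length_stateP2]; ring

/-- Every component of `ripple2 k` is a precision-2 float (`emin ≤ 0`).
[cite: JeannerodRump2018, §1] -/
theorem isFloat_of_mem_ripple2 (he : emin ≤ 0) (k : ℕ) : ∀ x ∈ ripple2 k, IsFloat 2 emin x := by
  intro x hx
  rw [ripple2_eq, List.mem_append] at hx
  rcases hx with hx | hx
  · exact isFloat_of_mem_zig3 he _ _ _ (Or.inr rfl) x hx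
  · exact isFloat_of_mem_ramp2 he
      (by rcases neg_one_pow_eq_or ℚ (k + 1) with h | h <;> simp [h]) _ _ x hx

/-- **`ripple2 k` is a nonoverlapping expansion.** [cite: Shewchuk1997, §2.1 (nonoverlapping)] -/
theorem isExpansion_ripple2 (k : ℕ) : IsExpansion 1 (ripple2 k) := by
  have hτ : ((-1 : ℚ)) ^ (k + 1) = 1 ∨ ((-1 : ℚ)) ^ (k + 1) = -1 := by
    rcases neg_one_pow_eq_or ℚ (k + 1) with h | h <;> simp [h]
  rw [ripple2_eq, IsExpansion, List.pairwise_append]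
  refine ⟨isExpansion_zig3 _ _ _ (Or.inr rfl), isExpansion_ramp2 hτ _ _, fun x hx y hy => ?_⟩
  obtain ⟨-, hlt⟩ := grid_of_mem_zig3 _ _ _ (Or.inr rfl) x hx
  exact ⟨((3 * (k + 1) : ℕ) : ℤ), grid_of_mem_ramp2 hτ _ _ y hy,
    by rw [one_mul, zpow_natCast]; simpa using hlt⟩

/-- Consecutive states differ (at position `j`: `4^j` versus `−3·4^j`). -/
theorem stateP2_succ_ne (j m : ℕ) : stateP2 (j + 1) m ≠ stateP2 j (m + 1) := by
  intro h
  have h' := congrArg (fun l : List ℚ => l[j]?) h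
  have hl : (ramp2 (1 : ℚ) 0 j).length = j := length_ramp2 1 0 j
  simp only [stateP2, ramp2_succ_eq_append, zig3_succ, List.append_assoc, List.cons_append] at h'
  rw [List.getElem?_append_right (by omega), List.getElem?_append_right (by omega), hl,
    Nat.sub_self, List.getElem?_cons_zero, List.getElem?_cons_zero, Option.some.injEq] at h'
  have : (0 : ℚ) < 2 ^ (2 * j) := by positivity
  have : (0 : ℚ) < 2 ^ (0 + 2 * j) := by positivity
  nlinarith

section main
variable (he : emin ≤ 0)
include he

/-- **THE PASSES of `ripple2 k`**: `j ≤ k + 1` passes give `stateP2 j (k + 1 − j)`; pass `k + 2`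
changes nothing. [cite: Shewchuk1997, §2.7 p. 332 (COMPRESS)] -/
theorem ripple2_passes (k : ℕ) :
    (∀ j ≤ k + 1, (compress (roundTiesEven 2 emin))^[j] (ripple2 k) = stateP2 j (k + 1 - j)) ∧
      (compress (roundTiesEven 2 emin))^[k + 2] (ripple2 k) =
        (compress (roundTiesEven 2 emin))^[k + 1] (ripple2 k) := by
  refine ⟨fun j hj => compress_iterate_stateP2 he (k + 1) j hj, ?_⟩
  rw [Function.iterate_succ_apply', ripple2, compress_iterate_stateP2 he (k + 1) (k + 1) le_rfl,
    Nat.sub_self, compress_stateP2_zero he]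

/-- Each of the first `k + 1` passes CHANGES the expansion. [cite: Shewchuk1997, §2.7 p. 332] -/
theorem ripple2_pass_changes (k j : ℕ) (hj : j ≤ k) :
    (compress (roundTiesEven 2 emin))^[j + 1] (ripple2 k) ≠
      (compress (roundTiesEven 2 emin))^[j] (ripple2 k) := by
  rw [(ripple2_passes he k).1 (j + 1) (by omega), (ripple2_passes he k).1 j (by omega),
    show k + 1 - j = (k - j) + 1 by omega, show k + 1 - (j + 1) = k - j by omega]
  exact stateP2_succ_ne j (k - j)

/-- **COMPRESS PASS COUNTS ARE UNBOUNDED AT PRECISION 2**: for every `k`, `ripple2 k` is a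
nonoverlapping expansion of `2k + 2` precision-2 floats on which COMPRESS (ties-to-even,
`emin ≤ 0`) changes its input in each of the first `k + 1` passes and is fixed afterwards.
[cite: Shewchuk1997, §2.7 p. 332 (COMPRESS)] -/
theorem compress_passes_unbounded_prec_two (k : ℕ) :
    ∃ e : List ℚ, e.length = 2 * k + 2 ∧ IsExpansion 1 e ∧ (∀ x ∈ e, IsFloat 2 emin x) ∧
      (∀ j ≤ k, (compress (roundTiesEven 2 emin))^[j + 1] e ≠
        (compress (roundTiesEven 2 emin))^[j] e) ∧
      (compress (roundTiesEven 2 emin))^[k + 2] e = (compress (roundTiesEven 2 emin))^[k + 1] e :=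
  ⟨ripple2 k, length_ripple2 k, isExpansion_ripple2 k, isFloat_of_mem_ripple2 he k,
    fun j hj => ripple2_pass_changes he k j hj, (ripple2_passes he k).2⟩

end main

/-- **AT EVERY PRECISION `p ≥ 2`**: for every `k` there is a nonoverlapping expansion of at most
`2k + 4` `p`-bit floats on which COMPRESS (`roundTiesEven p emin`, `emin ≤ 0`) changes its input in
each of the first `k + 1` passes and is fixed from pass `k + 2` on (`p = 2`: this file, `2k + 2`
components; `p ≥ 3`: `compress_passes_unbounded_all_prec`, `2k + 4` components).
[cite: Shewchuk1997, §2.7 p. 332 (COMPRESS)] -/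
theorem compress_passes_unbounded_every_prec (he : emin ≤ 0) {p : ℕ} (hp : 2 ≤ p) (k : ℕ) :
    ∃ e : List ℚ, e.length ≤ 2 * k + 4 ∧ IsExpansion 1 e ∧ (∀ x ∈ e, IsFloat p emin x) ∧
      (∀ j ≤ k, (compress (roundTiesEven p emin))^[j + 1] e ≠
        (compress (roundTiesEven p emin))^[j] e) ∧
      (compress (roundTiesEven p emin))^[k + 2] e =
        (compress (roundTiesEven p emin))^[k + 1] e := by
  rcases Nat.lt_or_ge p 3 with h3 | h3
  · obtain rfl : p = 2 := by omega
    obtain ⟨e, hl, hE, hF, hc, hf⟩ := compress_passes_unbounded_prec_two he k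
    exact ⟨e, by omega, hE, hF, hc, hf⟩
  · obtain ⟨e, hl, hE, hF, hc, hf⟩ := compress_passes_unbounded_all_prec he h3 k
    exact ⟨e, by omega, hE, hF, hc, hf⟩

end Summit.Ventures.CertifiedArithmetic.Expansions
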